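import Literature.NumberTheory.LFunctions.ClassGroupLFunctionExceptionalZeroQuadraticField
import Literature.NumberTheory.LFunctions.DirichletLOneLogBound
import Literature.NumberTheory.LFunctions.RealQuadraticClassNumberHalfSqrtBound
import Literature.NumberTheory.LFunctions.RamareLOneEvenConductor
import Literature.NumberTheory.QuadraticFields.ImaginaryResiduePiForm
import Mathlib.NumberTheory.NumberField.ClassNumber
import HarnessLib

/-!
# Explicit upper bounds `|L(1, χ)| ≤ ½ log q + C` for primitive Dirichlet characters (Ramaré 2001, 2004)

Topic `Literature/NumberTheory/LFunctions`, namespace `Literature.NumberTheory.LFunctions` (grouping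
sub-namespace `Ramare2001` for the proved readings). Statement layer typed by the cross-ladder
literature-typing seat `littype-FP2-2` (cells `parity-realchar`, `landau-siegel`): NAMED FACTS as printed
(D-0014) plus PROVED consequences. Companion of

* `DirichletLOneLogBound.lean` — the tree's PROVED elementary majoration
  `|L(1, χ)| ≤ H_{[(q−1)/2]} ≤ log q` for every `χ ≠ 1` mod `q` (Oesterlé 1988); the facts below halve the
  main term for PRIMITIVE characters (`½ log q`, Pólya–Vinogradov range), with the printed constants;
* `ClassNumberLeSqrtMulLog.lean` — `h(−d) ≤ π⁻¹ √d log d` (PROVED); modulo Ramaré's Corollary 1 this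
  becomes `h(−d) ≤ π⁻¹ √d (½ log d + 5/2 − log 6)` (`Ramare2001.classNumber_le`), and for REAL quadratic
  fields Corollary 2 (Le) is `h(ℚ(√q)) ≤ √q/2`;
* `SiegelTatuzawaExplicit.lean` / `ExplicitSiegelTatuzawaBound.lean` — the explicit Siegel–Tatuzawa line,
  whose proofs consume exactly these upper bounds (Hoffstein (12)–(14), Ji–Lu Lemma 4 = Louboutin
  1993/1996, Chen Lemma 3 = Ramaré 2001).

## Sources (read first-hand, text PDFs)

* O. Ramaré, *Approximate formulae for `L(1, χ)`*, Acta Arith. 100 (2001) 245–266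
  [Ramare2001LOneApproximateFormulae] (`paper:doi-10-4064-aa100-3-2`): p. 245 "For a primitive
  Dirichlet character `χ` of conductor `q ≠ 1` … we shall restrict our attention to upper bounds of the
  shape `½ log q + C` and seek the better `C`"; **Corollary 1** (p. 248): "Let `χ` be a primitive
  character of conductor `q`. Then `|L(1, χ)| ≤ ½ log q + 0` (`χ(−1) = 1`), `½ log q + 5/2 − log 6`
  (`χ(−1) = −1`). This indeed improves on S. Louboutin's bound, though by a (fairly) marginal factor since
  `5/2 − log 6 = 0.7082…`"; **Corollary 2 (Le)** (p. 248): "For every real quadratic field of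
  discriminant `q ≥ 16`, `h(ℚ(√q)) ≤ √q/2`"; **Corollary 3** (p. 248): "Let `χ` be a primitive character
  of even conductor `q`. Then `|L(1, χ)| ≤ ¼ log q + ½ log 2` (`χ(−1) = 1`), `¼ log q + 5/4 − ½ log 3`
  (`χ(−1) = −1`)." Context p. 247 (1.7): Louboutin 1993/1996/1998 had `½ log q + 0.023` (even),
  `+ 0.716` (odd); conjectures (1.1)–(1.2) p. 245 (`|L(1, χ)| ≤ ½ log q` for `q ≥ 4310`) are NOT typed.
* O. Ramaré, *Approximate formulae for `L(1, χ)`, II*, Acta Arith. 112 (2004) 141–149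
  [Ramare2004LOneApproximateFormulaeII] (`paper:doi-10-4064-aa112-2-4`): **Corollary 2** (p. 143): "Let
  `χ` be a primitive Dirichlet character modulo odd `q`. Then `|(1 − χ(2)/2) L(1, χ)| ≤ ¼(log q + κ(χ))`
  where `κ(χ) = 4 log 2` if `χ` is even, and `κ(χ) = 5 − 2 log(3/2)` otherwise." (Corollary 1 there, with
  two auxiliary parameters `h, k`, is indexed only.) P. 143 also records the typos of the 2001 paper
  (sign in Proposition 2, value of `ϱ₄`, "non-positive" on p. 264) — none affects the corollaries typed.

* D. R. Johnston, O. Ramaré, T. S. Trudgian, *An explicit upper bound for `L(1, χ)` when `χ` is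
  quadratic*, Res. Number Theory 9 (2023) art. 72 = arXiv:2303.13785 [JohnstonRamareTrudgian2023]
  (journal text `paper:doi-10-1007-s40993-023-00476-4` and arXiv v1 both held and read, §1; appended
  2026-08-27 by the same seat, g4): "We aim at making the Pintz–Stephens result partially explicit in
  the following theorems. **Theorem 1.** Let `χ` be a quadratic odd primitive Dirichlet character modulo
  `q ≥ 2·10²³`. We have `L(1, χ) ≤ (log q)/2`." ("For even characters, this is proved for `q ≥ 2` in
  [31]" = Corollary 1 above.) "**Theorem 2.** Let `χ` be a quadratic primitive Dirichlet character
  modulo `q`. The inequality `L(1, χ) ≤ (9/20) log q` holds true when `χ` is even and `q ≥ 2·10⁴⁹` or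
  `χ` is odd and `q ≥ 5·10⁵⁰`." (The journal and the arXiv abstract print `9/20`; arXiv v1's display of
  Theorem 2 has `9/40`, a misprint — `½(1 − e^{−1/2}) = 0.1967…` is the Stephens limit.) Typed as
  `johnstonRamareTrudgian2023_theorem1/2` with the PROVED readings
  `JohnstonRamareTrudgian2023.norm_LFunction_one_le_half_log` (every primitive quadratic `χ ≠ 1` mod
  `q ≥ 2·10²³`: `|L(1,χ)| ≤ ½ log q`, even case from Corollary 1) and `.classNumber_le_half_log`
  (`h_K ≤ √|d_K| log|d_K|/(2π)` for imaginary quadratic `K` with `|d_K| ≥ 2·10²³` — the printed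
  resolution, beyond `2·10²³`, of Ramaré's conjecture (1.1) for odd quadratic characters).

## How it is typed

"primitive character of conductor `q`" (`q ≠ 1`, p. 245) ↔ `χ : DirichletCharacter ℂ q`, `χ.IsPrimitive`,
`χ ≠ 1`; parity ↔ `χ.Even` / `χ.Odd`; `|L(1, χ)|` ↔ `‖χ.LFunction 1‖`; "real quadratic field of
discriminant `q`" ↔ number field `K` with `finrank ℚ K = 2` and `d_K = q > 0`, `h` = `NumberField.classNumber`.
PROVED: the parity-free reading `‖L(1, χ)‖ ≤ ½ log q + (5/2 − log 6)` (`Ramare2001.norm_LFunction_one_le`),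
and the class-number form for imaginary quadratic fields `h_K ≤ π⁻¹ √|d_K| (½ log|d_K| + 5/2 − log 6)`,
`d_K < −4` (`Ramare2001.classNumber_le`; Kronecker character `Quadratic.exists_primitive_kroneckerChar`,
class number formula `Quadratic.LFunction_one_eq_of_discr_neg_of_eq`, `w_K = 2`).

DISCHARGED (the named facts stay `def`s; consumers feed the `_holds` theorems):
* `ramare2001_corollary1_holds` — Corollary 1, both parities (`RamareLOneEvenSmoothing.lean`,
  `RamareLOneHalfLogOdd.lean`); hypothesis-free readings `Ramare2001.norm_LFunction_one_le'`,
  `Ramare2001.classNumber_le'`;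
* `ramare2001_corollary2_holds` — Corollary 2 (Le), `h_K ≤ √d_K/2` for real quadratic `K`, `d_K ≥ 16`
  (`RealQuadraticClassNumberHalfSqrtBound.lean`: (6.4) with a uniform secondary term, Lemma 19, the real
  class number formula `Res ζ_K = 2 h_K R_K/√d_K`);
* `ramare2001_corollary3_holds` — Corollary 3 (even conductor), both parities, every even `q`
  (`RamareLOneEvenConductor.lean`: §VII with Lemmas 11, 15, 16, 17).
Still named (unproved here): `ramare2004_corollary2`, `johnstonRamareTrudgian2023_theorem1/2`.

LABEL (cell rule): statement layer; unconditional printed theorems; no compute.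

## References

* [Ramare2001LOneApproximateFormulae] Cor 1–3 p. 248, (1.7) p. 247. * [Ramare2004LOneApproximateFormulaeII]
  Cor 2 p. 143. * [Oesterle1988Gauss] (tree comparison). * [NeukirchANT1999] VII (5.11) (class number formula).
* [JohnstonRamareTrudgian2023] Theorems 1–2 (§1; journal p. 2 / arXiv p. 1).
-/

noncomputable section

open Complex

namespace Literature.NumberTheory.LFunctions

/-! ### Named facts -/

/-- **Ramaré 2001, Corollary 1 (as printed, p. 248).** "Let `χ` be a primitive character of conductor
`q`. Then `|L(1, χ)| ≤ ½ log q + 0` if `χ(−1) = 1`, and `|L(1, χ)| ≤ ½ log q + 5/2 − log 6` if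
`χ(−1) = −1`." (`q ≠ 1`, p. 245; `5/2 − log 6 = 0.7082…`; improves Louboutin's `0.023` / `0.716`,
(1.7) p. 247.) [cite: Ramare2001LOneApproximateFormulae, Corollary 1 p. 248] -/
def ramare2001_corollary1 : Prop :=
  ∀ (q : ℕ) [NeZero q] (χ : DirichletCharacter ℂ q), χ.IsPrimitive → χ ≠ 1 →
    (χ.Even → ‖χ.LFunction 1‖ ≤ Real.log q / 2) ∧
    (χ.Odd → ‖χ.LFunction 1‖ ≤ Real.log q / 2 + (5 / 2 - Real.log 6))

/-- **Ramaré 2001, Corollary 2 (Le) (as printed, p. 248).** "For every real quadratic field of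
discriminant `q ≥ 16`, `h(ℚ(√q)) ≤ ½ √q`." (M. Le, Acta Arith. 68 (1994) 141–144; re-proved by Ramaré
from (6.4)–(6.5).) Typed over number fields `K` with `[K : ℚ] = 2` and `d_K = q ≥ 16`. PROVED:
`ramare2001_corollary2_holds` (`RealQuadraticClassNumberHalfSqrtBound.lean`, §IX with Lemma 19).
[cite: Ramare2001LOneApproximateFormulae, Corollary 2 p. 248] -/
def ramare2001_corollary2 : Prop :=
  ∀ (K : Type) [Field K] [NumberField K], Module.finrank ℚ K = 2 → (16 : ℤ) ≤ NumberField.discr K →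
    (NumberField.classNumber K : ℝ) ≤ Real.sqrt (NumberField.discr K : ℝ) / 2

/-- **Ramaré 2001, Corollary 3 (as printed, p. 248).** "Let `χ` be a primitive character of even
conductor `q`. Then `|L(1, χ)| ≤ ¼ log q + ½ log 2` if `χ(−1) = 1`, and
`|L(1, χ)| ≤ ¼ log q + 5/4 − ½ log 3` if `χ(−1) = −1`." (`½ log 2 = 0.34657…`, `5/4 − ½ log 3 = 0.70069…`;
Louboutin: `0.358…`, `0.704…`.) PROVED: `ramare2001_corollary3_holds` (`RamareLOneEvenConductor.lean`,
§VII). [cite: Ramare2001LOneApproximateFormulae, Corollary 3 p. 248] -/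
def ramare2001_corollary3 : Prop :=
  ∀ (q : ℕ) [NeZero q] (χ : DirichletCharacter ℂ q), χ.IsPrimitive → χ ≠ 1 → Even q →
    (χ.Even → ‖χ.LFunction 1‖ ≤ Real.log q / 4 + Real.log 2 / 2) ∧
    (χ.Odd → ‖χ.LFunction 1‖ ≤ Real.log q / 4 + (5 / 4 - Real.log 3 / 2))

/-- **Ramaré 2004, Corollary 2 (as printed, p. 143).** "Let `χ` be a primitive Dirichlet character
modulo odd `q`. Then `|(1 − χ(2)/2) L(1, χ)| ≤ ¼(log q + κ(χ))` where `κ(χ) = 4 log 2` if `χ` is even,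
and `κ(χ) = 5 − 2 log(3/2)` otherwise." (`q ≠ 1`: primitive non-principal.)
[cite: Ramare2004LOneApproximateFormulaeII, Corollary 2 p. 143] -/
def ramare2004_corollary2 : Prop :=
  ∀ (q : ℕ) [NeZero q] (χ : DirichletCharacter ℂ q), χ.IsPrimitive → χ ≠ 1 → Odd q →
    (χ.Even → ‖(1 - χ 2 / 2) * χ.LFunction 1‖ ≤ (Real.log q + 4 * Real.log 2) / 4) ∧
    (χ.Odd → ‖(1 - χ 2 / 2) * χ.LFunction 1‖ ≤ (Real.log q + (5 - 2 * Real.log (3 / 2))) / 4)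

/-! ### Proved readings -/

namespace Ramare2001

/-- Parity-free reading of Corollary 1: **`|L(1, χ)| ≤ ½ log q + (5/2 − log 6)`** for every primitive
`χ ≠ 1` mod `q` (the odd constant dominates: `log 6 < 5/2`). Compare the tree's unconditional
`DirichletAbel.norm_LFunction_one_le_log` (`≤ log q`, all `χ ≠ 1`).
[cite: Ramare2001LOneApproximateFormulae, Corollary 1 p. 248] -/
theorem norm_LFunction_one_le (h : ramare2001_corollary1) {q : ℕ} [NeZero q]
    (χ : DirichletCharacter ℂ q) (hprim : χ.IsPrimitive) (hne : χ ≠ 1) :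
    ‖χ.LFunction 1‖ ≤ Real.log q / 2 + (5 / 2 - Real.log 6) := by
  obtain ⟨heven, hodd⟩ := h q χ hprim hne
  have hlog6 : Real.log 6 < 5 / 2 := by
    have h2 : Real.log 6 < 2 := by
      rw [Real.log_lt_iff_lt_exp (by norm_num)]
      have he := Real.exp_one_gt_d9
      have : Real.exp 2 = Real.exp 1 ^ 2 := by rw [← Real.exp_nat_mul]; norm_num
      rw [this]
      nlinarith
    linarith
  rcases χ.even_or_odd with he | ho
  · linarith [heven he]
  · exact hodd ho

/-- **Class-number form for imaginary quadratic fields** (modulo Corollary 1): for `K` with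
`[K : ℚ] = 2`, `d_K < −4`: **`h_K ≤ π⁻¹ √|d_K| (½ log|d_K| + 5/2 − log 6)`** — half the main term of the
tree's PROVED `Quadratic.classNumber_le_sqrt_mul_log` (`π⁻¹ √|d_K| log|d_K|`, Oesterlé (27)). Proof: the
primitive Kronecker character `κ ≠ 1` mod `|d_K|` with `ζ_K = ζ·L(κ)`
(`Quadratic.exists_primitive_kroneckerChar`), the class number formula `L(1, κ) = 2π h_K/(w_K √|d_K|)`
with `w_K = 2`, and `norm_LFunction_one_le`. [cite: Ramare2001LOneApproximateFormulae, Corollary 1 p. 248]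
[cite: NeukirchANT1999, Ch. VII §5 (5.11)] -/
theorem classNumber_le (h : ramare2001_corollary1) (K : Type) [Field K] [NumberField K]
    (h2 : Module.finrank ℚ K = 2) (hd : NumberField.discr K < -4) :
    (NumberField.classNumber K : ℝ) ≤
      Real.pi⁻¹ * Real.sqrt ((NumberField.discr K).natAbs : ℝ) *
        (Real.log ((NumberField.discr K).natAbs : ℝ) / 2 + (5 / 2 - Real.log 6)) := by
  classical
  obtain ⟨M, _, κ, hM, hκ, -, hprim, hfac⟩ :=
    Literature.NumberTheory.QuadraticFields.Quadratic.exists_primitive_kroneckerChar h2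
  have hneg : NumberField.discr K < 0 := by omega
  have hcnf := Literature.NumberTheory.QuadraticFields.Quadratic.LFunction_one_eq_of_discr_neg_of_eq h2
    hneg hκ (fun s hs ↦ hfac s (by simpa using hs))
  have hw : (NumberField.Units.torsionOrder K : ℝ) = 2 := by
    exact_mod_cast
      Literature.NumberTheory.QuadraticFields.Quadratic.torsionOrder_eq_two_of_discr_lt_neg_four h2 hd
  have habs : |(NumberField.discr K : ℝ)| = (M : ℝ) := by
    rw [← Int.cast_abs, Int.abs_eq_natAbs, Int.cast_natCast, hM]
  have hM4 : (4 : ℝ) < M := by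
    rw [← habs]
    have : (NumberField.discr K : ℝ) < -4 := by exact_mod_cast hd
    rw [abs_of_neg (by linarith)]
    linarith
  have hB := norm_LFunction_one_le h κ hprim hκ
  rw [hcnf, Complex.norm_real, Real.norm_eq_abs, hw, habs, abs_of_nonneg (by positivity)] at hB
  have hsq : 0 < Real.sqrt (M : ℝ) := Real.sqrt_pos.2 (by linarith)
  have hπ := Real.pi_pos
  rw [div_le_iff₀ (by positivity)] at hB
  rw [← hM]
  -- `2π h ≤ B · (2 √M)` ⇒ `h ≤ π⁻¹ √M · B`
  calc (NumberField.classNumber K : ℝ)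
      = Real.pi⁻¹ * (2 * Real.pi * NumberField.classNumber K) / 2 := by field_simp
    _ ≤ Real.pi⁻¹ * ((Real.log M / 2 + (5 / 2 - Real.log 6)) * (2 * Real.sqrt M)) / 2 := by
        gcongr
    _ = Real.pi⁻¹ * Real.sqrt M * (Real.log M / 2 + (5 / 2 - Real.log 6)) := by ring

end Ramare2001

/-! ### Johnston–Ramaré–Trudgian 2023: `L(1, χ) ≤ ½ log q` and `≤ (9/20) log q` for quadratic `χ` -/

/-- **Johnston–Ramaré–Trudgian 2023, Theorem 1 (NAMED FACT, as printed).** "Let `χ` be a quadratic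
odd primitive Dirichlet character modulo `q ≥ 2·10²³`. We have `L(1, χ) ≤ (log q)/2`." (`L(1, χ) > 0`
is real for quadratic `χ`; rendered on `‖L(1, χ)‖` as in the rest of this file — the abstract prints
`|L(1,χ)| ≤ ½ log q`.) Unproved here (explicit Pintz–Stephens method, §§2–7).
[cite: JohnstonRamareTrudgian2023, Theorem 1] -/
def johnstonRamareTrudgian2023_theorem1 : Prop :=
  ∀ (q : ℕ) [NeZero q] (χ : DirichletCharacter ℂ q), χ.IsQuadratic → χ.IsPrimitive → χ.Odd →
    (2 * 10 ^ 23 : ℝ) ≤ q → ‖χ.LFunction 1‖ ≤ Real.log q / 2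

/-- **Johnston–Ramaré–Trudgian 2023, Theorem 2 (NAMED FACT, as printed in the journal).** "Let `χ` be a
quadratic primitive Dirichlet character modulo `q`. The inequality `L(1, χ) ≤ (9/20) log q` holds true
when `χ` is even and `q ≥ 2·10⁴⁹` or `χ` is odd and `q ≥ 5·10⁵⁰`." (arXiv v1 misprints `9/40` in this
display; its abstract and the journal have `9/20`.) Unproved here.
[cite: JohnstonRamareTrudgian2023, Theorem 2] -/
def johnstonRamareTrudgian2023_theorem2 : Prop :=
  ∀ (q : ℕ) [NeZero q] (χ : DirichletCharacter ℂ q), χ.IsQuadratic → χ.IsPrimitive → χ ≠ 1 →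
    (χ.Even ∧ (2 * 10 ^ 49 : ℝ) ≤ q ∨ χ.Odd ∧ (5 * 10 ^ 50 : ℝ) ≤ q) →
      ‖χ.LFunction 1‖ ≤ 9 / 20 * Real.log q

namespace JohnstonRamareTrudgian2023

/-- **`|L(1, χ)| ≤ ½ log q` for EVERY primitive quadratic `χ ≠ 1` mod `q ≥ 2·10²³`** — even characters
by Ramaré's Corollary 1 (all `q`), odd ones by Theorem 1. [cite: JohnstonRamareTrudgian2023, Theorem 1]
[cite: Ramare2001LOneApproximateFormulae, Corollary 1 p. 248] -/
theorem norm_LFunction_one_le_half_log (hR : ramare2001_corollary1)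
    (hJ : johnstonRamareTrudgian2023_theorem1) {q : ℕ} [NeZero q] (χ : DirichletCharacter ℂ q)
    (hquad : χ.IsQuadratic) (hprim : χ.IsPrimitive) (hne : χ ≠ 1) (hq : (2 * 10 ^ 23 : ℝ) ≤ q) :
    ‖χ.LFunction 1‖ ≤ Real.log q / 2 := by
  rcases χ.even_or_odd with he | ho
  · exact (hR q χ hprim hne).1 he
  · exact hJ q χ hquad hprim ho hq

/-- **Class-number form**: for an imaginary quadratic field `K` (`[K:ℚ] = 2`) with `|d_K| ≥ 2·10²³`,
**`h_K ≤ √|d_K| · log|d_K| / (2π)`** — modulo Theorem 1 (and Corollary 1 for the formal even case),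
via the primitive Kronecker character and the class number formula with `w_K = 2`, exactly as
`Ramare2001.classNumber_le`. [cite: JohnstonRamareTrudgian2023, Theorem 1]
[cite: NeukirchANT1999, Ch. VII §5 (5.11)] -/
theorem classNumber_le_half_log (hR : ramare2001_corollary1) (hJ : johnstonRamareTrudgian2023_theorem1)
    (K : Type) [Field K] [NumberField K] (h2 : Module.finrank ℚ K = 2) (hneg : NumberField.discr K < 0)
    (hd : (2 * 10 ^ 23 : ℝ) ≤ (NumberField.discr K).natAbs) :
    (NumberField.classNumber K : ℝ) ≤
      Real.sqrt ((NumberField.discr K).natAbs : ℝ) * Real.log ((NumberField.discr K).natAbs : ℝ) /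
        (2 * Real.pi) := by
  classical
  obtain ⟨M, _, κ, hM, hκ, hsq, hprim, hfac⟩ :=
    Literature.NumberTheory.QuadraticFields.Quadratic.exists_primitive_kroneckerChar h2
  have hd4 : NumberField.discr K < -4 := by
    have h23 : (2 * 10 ^ 23 : ℝ) ≤ ((NumberField.discr K).natAbs : ℝ) := hd
    have hnat : (5 : ℝ) ≤ ((NumberField.discr K).natAbs : ℝ) := le_trans (by norm_num) h23
    have hnat' : 5 ≤ (NumberField.discr K).natAbs := by exact_mod_cast hnat
    omega
  have hcnf := Literature.NumberTheory.QuadraticFields.Quadratic.LFunction_one_eq_of_discr_neg_of_eq h2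
    hneg hκ (fun s hs ↦ hfac s (by simpa using hs))
  have hw : (NumberField.Units.torsionOrder K : ℝ) = 2 := by
    exact_mod_cast
      Literature.NumberTheory.QuadraticFields.Quadratic.torsionOrder_eq_two_of_discr_lt_neg_four h2 hd4
  have habs : |(NumberField.discr K : ℝ)| = (M : ℝ) := by
    rw [← Int.cast_abs, Int.abs_eq_natAbs, Int.cast_natCast, hM]
  have hMq : (2 * 10 ^ 23 : ℝ) ≤ (M : ℝ) := by rw [hM]; exact hd
  have hM4 : (4 : ℝ) < M := lt_of_lt_of_le (by norm_num) hMq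
  have hquad : κ.IsQuadratic := MulChar.isQuadratic_iff_sq_eq_one.mpr hsq
  have hB := norm_LFunction_one_le_half_log hR hJ κ hquad hprim hκ hMq
  rw [hcnf, Complex.norm_real, Real.norm_eq_abs, hw, habs, abs_of_nonneg (by positivity)] at hB
  have hsqM : 0 < Real.sqrt (M : ℝ) := Real.sqrt_pos.2 (by linarith)
  have hπ := Real.pi_pos
  rw [div_le_iff₀ (by positivity)] at hB
  rw [← hM]
  -- `2π h ≤ (log M / 2) · (2 √M)` ⇒ `h ≤ √M log M / (2π)`
  rw [le_div_iff₀ (by positivity)]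
  nlinarith

end JohnstonRamareTrudgian2023

/-! ### Discharge of `ramare2001_corollary1` -/

/-- **Ramaré 2001, Corollary 1 — PROVED.** The even half is
`Ramare2001.norm_LFunction_one_le_half_log_of_even` (`RamareLOneEvenSmoothing.lean`: Proposition 2
with Vaaler's `F₃ = H` and `δ = q^{-1/2}` for `log q ≥ 10`, Louboutin's `½ log q + µ − (½ log q − µ)/√q`
below), the odd half `Ramare2001.norm_LFunction_one_le_half_log_add_of_odd`
(`RamareLOneHalfLogOdd.lean`: Proposition 2 with `F₄ = 1 − K`, Lemma 17, `δq = ⌊3√q/π⌋`).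
[cite: Ramare2001LOneApproximateFormulae, Corollary 1 p. 248] -/
theorem ramare2001_corollary1_holds : ramare2001_corollary1 := fun _ _ χ hχ hne =>
  ⟨fun heven => Ramare2001.norm_LFunction_one_le_half_log_of_even χ hχ hne heven,
   fun hodd => Ramare2001.norm_LFunction_one_le_half_log_add_of_odd χ hχ hodd⟩

/-- **`|L(1, χ)| ≤ ½ log q + (5/2 − log 6)` for every primitive `χ ≠ 1` mod `q`, hypothesis-free**
(`Ramare2001.norm_LFunction_one_le` fed `ramare2001_corollary1_holds`).
[cite: Ramare2001LOneApproximateFormulae, Corollary 1 p. 248] -/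
theorem Ramare2001.norm_LFunction_one_le' {q : ℕ} [NeZero q] (χ : DirichletCharacter ℂ q)
    (hprim : χ.IsPrimitive) (hne : χ ≠ 1) :
    ‖χ.LFunction 1‖ ≤ Real.log q / 2 + (5 / 2 - Real.log 6) :=
  Ramare2001.norm_LFunction_one_le ramare2001_corollary1_holds χ hprim hne

/-- **`h_K ≤ π⁻¹ √|d_K| (½ log|d_K| + 5/2 − log 6)` for every imaginary quadratic field `K` with
`d_K < −4`, hypothesis-free** (`Ramare2001.classNumber_le` fed `ramare2001_corollary1_holds`).
[cite: Ramare2001LOneApproximateFormulae, Corollary 1 p. 248] [cite: NeukirchANT1999, Ch. VII §5 (5.11)] -/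
theorem Ramare2001.classNumber_le' (K : Type) [Field K] [NumberField K]
    (h2 : Module.finrank ℚ K = 2) (hd : NumberField.discr K < -4) :
    (NumberField.classNumber K : ℝ) ≤
      Real.pi⁻¹ * Real.sqrt ((NumberField.discr K).natAbs : ℝ) *
        (Real.log ((NumberField.discr K).natAbs : ℝ) / 2 + (5 / 2 - Real.log 6)) :=
  Ramare2001.classNumber_le ramare2001_corollary1_holds K h2 hd

/-! ### Discharge of `ramare2001_corollary2` and `ramare2001_corollary3` -/

/-- **Ramaré 2001, Corollary 2 (Le) — PROVED**: `Ramare2001.classNumber_le_half_sqrt`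
(`RealQuadraticClassNumberHalfSqrtBound.lean`: the class number formula `Res_{s=1} ζ_K = 2 h_K R_K/√d_K`,
the even bound `|L(1, κ_K)| ≤ ½ log(d_K − 4)` from (6.4)/Louboutin, and Lemma 19 `R_K ≥ ½ log(d_K − 4)`).
[cite: Ramare2001LOneApproximateFormulae, Corollary 2 p. 248 / §IX p. 265] [cite: Le1994, Theorem (a) p. 141] -/
theorem ramare2001_corollary2_holds : ramare2001_corollary2 := fun _ _ _ h2 h16 =>
  Ramare2001.classNumber_le_half_sqrt h2 h16

/-- **Ramaré 2001, Corollary 3 — PROVED**: `Ramare2001.norm_LFunction_one_le_quarter_log_add_of_even`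
and `…_of_odd` (`RamareLOneEvenConductor.lean`: Proposition 2 with `F₃`/`F₄`, (7.1), Lemmas 11, 15, 17,
`δ = q^{-1/2}` resp. `3/(π√q)`; every even conductor). [cite: Ramare2001LOneApproximateFormulae, Corollary 3 p. 248 / §VII pp. 263–264] -/
theorem ramare2001_corollary3_holds : ramare2001_corollary3 := fun _ _ χ hχ hne hq =>
  ⟨fun heven => Ramare2001.norm_LFunction_one_le_quarter_log_add_of_even χ hχ hne heven hq,
   fun hodd => Ramare2001.norm_LFunction_one_le_quarter_log_add_of_odd χ hχ hodd hq⟩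

end Literature.NumberTheory.LFunctions

end
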